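import Summits.BirchSwinnertonDyer.Rank1Residual.X11b.RouteR1LogOmega
import Summits.BirchSwinnertonDyer.Rank1Residual.Partition.MainConjecturesAnticyclotomic
import Summits.BirchSwinnertonDyer.Rank1Residual.Additive.AnticycJointLower
import Summits.BirchSwinnertonDyer.Rank1Residual.Additive.O7RankOneStatements
import Summits.BirchSwinnertonDyer.Rank1Residual.X11b.AnticyclotomicControlFromAtoms
import Summits.BirchSwinnertonDyer.Rank1Residual.Additive.X3SharpResidue
import HarnessLib
import HarnessLib.Audit.Tags

/-!
# Schneider-free sockets at an additive prime + the rung leaf `AdditiveX3RankOneLower`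
(cell `bsd-schneider-ideate`, seat P2 «around»; HUMAN RULINGS D-0059 / D-0061, 2026-08-25)

PROPOSED TREE FILE `Summits/BirchSwinnertonDyer/BirchSwinnertonDyer/Theorems/SchneiderFreeSockets.lean` —
STATEMENTS ONLY, NOTHING ASSERTED: five `@[conjecture]` predicates (the typed inputs of the
anticyclotomic / BDP door at an ADDITIVE potentially-ordinary prime, memo
`pub/bsd-schneider-ideate/memos/ROUTE-P2.md` v5 §9–§11, kernel-checked in `memos/ROUTE-P2-Sketch.lean`
v5 §1/§1b) and ONE CLOSED rung leaf `AdditiveX3RankOneLower : Prop` (no section variables) — the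
`--closes-target` of the planned route `SchneiderFreeAdditiveX3` (D-0061 R5). Three reading theorems
place the leaf inside the tree's own conjecture-shaped statements (`O7.LowerHalf`, `O7.PPart`, the
rank-one residue of X3♯).

* `AdditiveIMCLowerBDPOnTreeAt` — T-B6-1 (pointwise): (Greenberg/BDP main conjecture ⊇ at 𝟙) ∘
  (Liu–Zhang–Zhang value) at an additive `p` split in `K`: `2·ord_p log_ω P ≤ ord_p f(0)`, Euler shift `0`.
* `AdditiveControlOnTreeAt` — T-B6-2′ (pointwise): anticyclotomic control EQUALITY at an additive `p`.
* `AdditiveStepLInputAt W p` — T-B6-3: STEP L (JSW17 (eq:shalowerK-1), X11b currency) on the N10 locus.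
* `AdditiveIMCLowerBDPInputAt W p`, `AdditiveControlInputAt W p` — T-B6-1♯ / T-B6-2′♯: the pointwise
  predicates quantified over the B6 Heegner data and every anticyclotomic frame.
* `HeegnerTwistDataAt W p`, `JointLowerOfStepL` — route-side packaged predicates (Heegner-twist data;
  Gross–Zagier bookkeeping). The partner's UPPER half on the rank-zero semistable-twist X3 rows is NOT
  given a closed name here (the route item `PartnerUpperX3RankZero` spells it out); the theorem
  `partnerUpperX3RankZero_of_facts` re-keys it to the tree theorem
  `ClassX3.missingUpperBoundAt_rankZero_of_subSemistableTwist` modulo named facts.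
* `AdditiveX3RankOneLower` — the LEAF: lower half of BSD_p on X3 ∧ semistable twist ∧ `r_an = 1`.
-/

noncomputable section

open scoped Classical

open WeierstrassCurve NumberField IsDedekindDomain Field Literature.NumberTheory.EllipticCurves
  Literature.NumberTheory.EllipticCurves.ModularForms
  Literature.NumberTheory.EllipticCurves.GreenbergSelmer
  Literature.NumberTheory.EllipticCurves.Rank1Residual
  Literature.NumberTheory.EllipticCurves.Rank1Residual.Typed
  Summit.BirchSwinnertonDyer.Rank1Residual
  Summit.BirchSwinnertonDyer.Rank1Residual.X11b
  Summit.BirchSwinnertonDyer.Rank1Residual.X11b.AcSelmer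
  Summit.BirchSwinnertonDyer.Rank1Residual.X11b.Halves

set_option linter.dupNamespace false

namespace Summit.BirchSwinnertonDyer.BirchSwinnertonDyer.Theorems.SchneiderFree

/-- **T-B6-1 (pointwise link; NONE ∘ PUB).** (IMC ⊇) ∘ (LZZ `p`-adic Waldspurger at `𝟙`) at an
ADDITIVE prime `p` split in `K`: for a generator `f` (with `f(0) ≠ 0`) of the characteristic ideal of
the Greenberg/BDP module `XAc (E_K) p κ 𝔭 ∅ γ` (strict at `𝔭`, relaxed at `𝔭̄`),
`2·ord_p log_{ω_E} P ≤ ord_p f(0)` — X11b's `IMCLowerWaldspurgerOnTreeAt` with the Euler shift `−1`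
replaced by `0` (`a_p(E) = 0` at an additive prime). Analytic half PUB (Liu–Zhang–Zhang: only `𝔭`
split is needed); divisibility half NONE in print at `p² ∣ N`. A predicate; nothing asserted.
[cite: LiuZhangZhang2018, Thm. 1.8] [cite: JetchevSkinnerWan2017, §7.4.1] -/
@[conjecture]
def AdditiveIMCLowerBDPOnTreeAt (p : ℕ) [Fact p.Prime] {K : Type} [Field K] [NumberField K]
    {W : WeierstrassCurve ℚ} [W.IsElliptic] [W.IsGloballyMinimal] (κ : ZpExtension K p)
    (𝔭 : HeightOneSpectrum (𝓞 K)) (γ : Field.absoluteGaloisGroup K) [Fact (κ.IsTopGenerator γ)]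
    (ι : K →+* ℚ_[p]) (P : (W.baseChange K).toAffine.Point) : Prop :=
  ∃ n : ℕ, XAc.HasCharValuationAt (W.baseChange K) p κ 𝔭 ∅ γ n ∧
    2 * X11b.padicLogOrd W p ι P ≤ (n : ℤ)

/-- **T-B6-2′ (pointwise control EQUALITY at an additive prime; DERIVED from JSW17 Prop. 6 / Thm. 8
off their Case 3(b)).** For a generator `f` of the characteristic ideal of `XAc (E_K) p κ 𝔭 ∅ γ`,
`ord_p f(0) = ord_p #Ш(E/K)[p^∞] + 2·(ord_p log_ω P − ord_p[E(K):ℤP]) + ord_p ∏_{w∣N⁺} c_w(E/K)`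
(Euler shift `0`; the local `p`-torsion exponent `t_p` cancels). A predicate; nothing asserted.
[cite: JetchevSkinnerWan2017, Thm. 3.3.1] -/
@[conjecture]
def AdditiveControlOnTreeAt (p : ℕ) [Fact p.Prime] {K : Type} [Field K] [NumberField K]
    {W : WeierstrassCurve ℚ} [W.IsElliptic] [W.IsGloballyMinimal] (κ : ZpExtension K p)
    (𝔭 : HeightOneSpectrum (𝓞 K)) (γ : Field.absoluteGaloisGroup K) [Fact (κ.IsTopGenerator γ)]
    (ι : K →+* ℚ_[p]) (P : (W.baseChange K).toAffine.Point) : Prop :=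
  ∃ n : ℕ, XAc.HasCharValuationAt (W.baseChange K) p κ 𝔭 ∅ γ n ∧
    (n : ℤ) = (padicValNat p (Nat.card (AddCommGroup.primaryComponent (W.baseChange K).sha p)) : ℤ) +
      2 * (X11b.padicLogOrd W p ι P - (padicValNat p (AddSubgroup.zmultiples P).index : ℤ)) +
        padicValNat p (X11b.tamagawaProductSplit W K)

/-- **T-B6-3 (STEP L at an additive potentially-ordinary prime, X11b currency; OUR typed input).** On
the N10 locus (odd additive `p`, (M) ∨ (G-ord)) with `r_an = 1`, for every Heegner datum over a
Heegner field `K` (all `ℓ ∣ N` split, so `p` splits), odd `d_K`, `p ∤ #𝓞_K^×`, `L(E^{d_K},1) ≠ 0`,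
`p ∤ c`, `P` the (non-torsion) Heegner point: `X11b.IndexLowerBoundAt W p K P`. A predicate; nothing
asserted. [cite: JetchevSkinnerWan2017, §7.4.1] -/
@[conjecture]
def AdditiveStepLInputAt (W : WeierstrassCurve ℚ) [W.IsElliptic] [W.IsGloballyMinimal] (p : ℕ)
    [Fact p.Prime] : Prop :=
  ∀ (N : ℕ) [NeZero N] (K : Type) [Field K] [NumberField K]
    (Dt : ModularParametrizationData W N) (H : HeegnerDatum N (NumberField.discr K)) (ι : K →+* ℂ)
    (P : (W.baseChange K).toAffine.Point),
    W.analyticRank = 1 → Additive.N10.Locus W p → W.conductorNorm ℤ = N → IsImaginaryQuadratic K →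
    Odd (NumberField.discr K) → ¬ p ∣ Units.torsionOrder K → SatisfiesHeegnerHypothesis N K →
    (W.quadraticTwist (NumberField.discr K : ℚ)).entireLFunction 1 ≠ 0 →
    WeierstrassCurve.Affine.Point.map ι.toRatAlgHom P = heegnerPointComplex Dt H →
    ¬ (p : ℤ) ∣ Dt.c → ¬ IsOfFinAddOrder P → IndexLowerBoundAt W p K P

/-- **T-B6-1♯ (T-B6-1 quantified over the B6 data and every anticyclotomic frame `(κ, γ, 𝔭)` with
`𝔭 ∣ p` of degree one).** A predicate; nothing asserted. [cite: LiuZhangZhang2018, Thm. 1.8] -/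
@[conjecture]
def AdditiveIMCLowerBDPInputAt (W : WeierstrassCurve ℚ) [W.IsElliptic] [W.IsGloballyMinimal] (p : ℕ)
    [Fact p.Prime] : Prop :=
  ∀ (N : ℕ) [NeZero N] (K : Type) [Field K] [NumberField K]
    (Dt : ModularParametrizationData W N) (H : HeegnerDatum N (NumberField.discr K)) (ι : K →+* ℂ)
    (P : (W.baseChange K).toAffine.Point),
    W.analyticRank = 1 → Additive.N10.Locus W p → W.conductorNorm ℤ = N → IsImaginaryQuadratic K →
    Odd (NumberField.discr K) → ¬ p ∣ Units.torsionOrder K → SatisfiesHeegnerHypothesis N K →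
    (W.quadraticTwist (NumberField.discr K : ℚ)).entireLFunction 1 ≠ 0 →
    WeierstrassCurve.Affine.Point.map ι.toRatAlgHom P = heegnerPointComplex Dt H →
    ¬ (p : ℤ) ∣ Dt.c → ¬ IsOfFinAddOrder P →
    ∀ (κ : ZpExtension K p), κ.IsAnticyclotomic →
      ∀ (γ : Field.absoluteGaloisGroup K) [Fact (κ.IsTopGenerator γ)]
        (𝔭 : HeightOneSpectrum (𝓞 K)) (h𝔭 : ((p : ℕ) : 𝓞 K) ∈ 𝔭.asIdeal)
        (he : 𝔭.asIdeal.ramificationIdx (𝓞 ℚ) = 1) (hf : 𝔭.asIdeal.inertiaDeg (𝓞 ℚ) = 1),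
        AdditiveIMCLowerBDPOnTreeAt p κ 𝔭 γ (embAt K p 𝔭 h𝔭 he hf) P

/-- **T-B6-2′♯ (T-B6-2′ quantified over the B6 data and every anticyclotomic frame).** A predicate;
nothing asserted. [cite: JetchevSkinnerWan2017, Thm. 3.3.1] -/
@[conjecture]
def AdditiveControlInputAt (W : WeierstrassCurve ℚ) [W.IsElliptic] [W.IsGloballyMinimal] (p : ℕ)
    [Fact p.Prime] : Prop :=
  ∀ (N : ℕ) [NeZero N] (K : Type) [Field K] [NumberField K]
    (Dt : ModularParametrizationData W N) (H : HeegnerDatum N (NumberField.discr K)) (ι : K →+* ℂ)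
    (P : (W.baseChange K).toAffine.Point),
    W.analyticRank = 1 → Additive.N10.Locus W p → W.conductorNorm ℤ = N → IsImaginaryQuadratic K →
    Odd (NumberField.discr K) → ¬ p ∣ Units.torsionOrder K → SatisfiesHeegnerHypothesis N K →
    (W.quadraticTwist (NumberField.discr K : ℚ)).entireLFunction 1 ≠ 0 →
    WeierstrassCurve.Affine.Point.map ι.toRatAlgHom P = heegnerPointComplex Dt H →
    ¬ (p : ℤ) ∣ Dt.c → ¬ IsOfFinAddOrder P →
    ∀ (κ : ZpExtension K p), κ.IsAnticyclotomic →
      ∀ (γ : Field.absoluteGaloisGroup K) [Fact (κ.IsTopGenerator γ)]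
        (𝔭 : HeightOneSpectrum (𝓞 K)) (h𝔭 : ((p : ℕ) : 𝓞 K) ∈ 𝔭.asIdeal)
        (he : 𝔭.asIdeal.ramificationIdx (𝓞 ℚ) = 1) (hf : 𝔭.asIdeal.inertiaDeg (𝓞 ℚ) = 1),
        AdditiveControlOnTreeAt p κ 𝔭 γ (embAt K p 𝔭 h𝔭 he hf) P

/-! ### Route-side packaged predicates (so that the route file `Theses/SchneiderFreeAdditiveX3.lean`,
rendered WITHOUT `open scoped Classical`, can state its support items by name; all typing that needs the
trunk's classical `DecidableEq K` on `E(K)` lives here). Predicates / closed statements; nothing asserted. -/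

/-- **Heegner-twist data on the cells (support `HeegnerTwistChoice` of the route, pointwise).** For the
pair `(W, p)`: a level `N = N_E`, a Heegner field `K` (imaginary quadratic, odd `d_K`, `p ∤ #𝓞_K^×`,
every `ℓ ∣ N` split — so the additive `p` splits), `L(E^{d_K}, 1) ≠ 0`, a modular parametrisation
with `p ∤ c` and its Heegner point `P` (non-torsion), and a globally minimal model `Wd` of the twist
`E^{d_K}` with `r_an(Wd) = 0` on the SAME cells (`d_K ∈ (ℚ_p^×)²`). Existence is Gross–Zagier +
Bump–Friedberg–Hoffstein / Murty–Murty + bookkeeping. A predicate; nothing asserted.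
[cite: GrossZagier1986, Thm. I.(6.3)] -/
def HeegnerTwistDataAt (W : WeierstrassCurve ℚ) [W.IsElliptic] [W.IsGloballyMinimal] (p : ℕ)
    [Fact p.Prime] : Prop :=
  ∃ (N : ℕ) (_ : NeZero N) (K : Type) (_ : Field K) (_ : NumberField K)
    (Dt : ModularParametrizationData W N) (H : HeegnerDatum N (NumberField.discr K)) (ι : K →+* ℂ)
    (P : (W.baseChange K).toAffine.Point) (Wd : WeierstrassCurve ℚ) (_ : Wd.IsElliptic)
    (_ : Wd.IsGloballyMinimal),
    W.conductorNorm ℤ = N ∧ IsImaginaryQuadratic K ∧ Odd (NumberField.discr K) ∧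
    ¬ p ∣ Units.torsionOrder K ∧ SatisfiesHeegnerHypothesis N K ∧
    (W.quadraticTwist (NumberField.discr K : ℚ)).entireLFunction 1 ≠ 0 ∧
    WeierstrassCurve.Affine.Point.map ι.toRatAlgHom P = heegnerPointComplex Dt H ∧
    ¬ (p : ℤ) ∣ Dt.c ∧ ¬ IsOfFinAddOrder P ∧
    (∃ C : VariableChange ℚ, C • W.quadraticTwist (NumberField.discr K : ℚ) = Wd) ∧
    Wd.analyticRank = 0 ∧ ClassX3 Wd p ∧ Additive.SubSemistableTwist Wd p

/-- **Gross–Zagier bookkeeping (support `JointLowerOfStepL` of the route; CLOSED).** STEP L over the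
Heegner field (`X11b.IndexLowerBoundAt W p K P`) + Gross–Zagier I.(7.3) + `L(E/K,s) = L(E,s)·L(E^{d_K},s)`
+ `Ш(E/K)[p^∞] ≅ Ш(E) ⊕ Ш(E^{d_K})` (odd `p`) ⟹ the JOINT lower half `JointLowerBoundAt W Wd p` in
Miller's currency. PUB inputs + bookkeeping; nothing asserted. [cite: GrossZagier1986, Thm. I.(7.3)]
[cite: JetchevSkinnerWan2017, §7.4.1] -/
@[conjecture]
def JointLowerOfStepL : Prop :=
  ∀ (W : WeierstrassCurve ℚ) [W.IsElliptic] [W.IsGloballyMinimal] (p : ℕ) [Fact p.Prime]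
    (N : ℕ) [NeZero N] (K : Type) [Field K] [NumberField K]
    (Dt : ModularParametrizationData W N) (H : HeegnerDatum N (NumberField.discr K)) (ι : K →+* ℂ)
    (P : (W.baseChange K).toAffine.Point) (Wd : WeierstrassCurve ℚ) [Wd.IsElliptic]
    [Wd.IsGloballyMinimal],
    W.analyticRank = 1 → W.conductorNorm ℤ = N → IsImaginaryQuadratic K →
    Odd (NumberField.discr K) → ¬ p ∣ Units.torsionOrder K → SatisfiesHeegnerHypothesis N K →
    (W.quadraticTwist (NumberField.discr K : ℚ)).entireLFunction 1 ≠ 0 →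
    WeierstrassCurve.Affine.Point.map ι.toRatAlgHom P = heegnerPointComplex Dt H →
    ¬ (p : ℤ) ∣ Dt.c → ¬ IsOfFinAddOrder P →
    (∃ C : VariableChange ℚ, C • W.quadraticTwist (NumberField.discr K : ℚ) = Wd) →
    Wd.analyticRank = 0 → p ≠ 2 → IndexLowerBoundAt W p K P → JointLowerBoundAt W Wd p

/-- **Partner upper half (the route's support item `PartnerUpperX3RankZero`, spelled out).** The UPPER
half on the rank-ZERO semistable-twist X3 rows at every odd `p` IS the tree theorem
`Additive.ClassX3.missingUpperBoundAt_rankZero_of_subSemistableTwist` modulo its six named PUB facts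
(kernel-checked re-key; no closed `def` is declared for it in this file).
[cite: Delbourgo1998, Prop. 4 (p. 144)] [cite: Wuthrich2014, Thm. 16 (p. 397)] -/
theorem partnerUpperX3RankZero_of_facts
    (hDel : Delbourgo1998.prop4_rankZero_pow_dvd_constantCoeff)
    (hGZK : rank_eq_analyticRank_of_analyticRank_le_one) (hmod : hasEntireLFunction_rat)
    (hmodD : nonempty_modularParametrizationData)
    (hW16 : Wuthrich2014.thm16_halfEigenCharIdeal_dvd_cyclotomicPrime)
    (hWu : Wuthrich2014.charIdeal_dvd_padicLFunctionBranch_component) :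
    ∀ (Wd : WeierstrassCurve ℚ) [Wd.IsElliptic] [Wd.IsGloballyMinimal] (p : ℕ) [Fact p.Prime],
      Wd.analyticRank = 0 → p ≠ 2 → ClassX3 Wd p → Additive.SubSemistableTwist Wd p →
        MissingUpperBoundAt Wd p := fun Wd _ _ p _ hr hp2 hX hS ↦
  Additive.ClassX3.missingUpperBoundAt_rankZero_of_subSemistableTwist Wd p hDel hGZK hmod hmodD hW16
    hWu hp2 hX hr hS

/-- **RUNG LEAF `AdditiveX3RankOneLower` (D-0059 / D-0061; seat P2 «around»).** On row B6's reducible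
semistable-twist cells in analytic rank one, the LOWER half of BSD_p: for every globally minimal
`E/ℚ` with `r_an(E) = 1`, every odd additive `p` with `E[p]` reducible (`ClassX3`) and `E^{(p*)}`
semistable at `p` (`SubSemistableTwist` = (M) ∪ (G-ord, `e = 2`); 7 101 of B6's 11 505 pairs,
6 794 at `p = 3`), `#Ш(E)_an` is a rational `q` with `ord_p q ≤ ord_p #Ш(E)` (`MissingLowerBoundAt`).
CLOSED (no section variables); OPEN; nothing asserted. [cite: Miller2011LMS, Def. 1.1] -/
@[conjecture]
def AdditiveX3RankOneLower : Prop :=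
  ∀ (W : WeierstrassCurve ℚ) [W.IsElliptic] [W.IsGloballyMinimal] (p : ℕ) [Fact p.Prime],
    W.analyticRank = 1 → p ≠ 2 → ClassX3 W p → Additive.SubSemistableTwist W p →
      MissingLowerBoundAt W p

/-- Closedness check: the leaf is a `Prop` with no hidden binders. [folklore] -/
example : (id AdditiveX3RankOneLower : Prop) = AdditiveX3RankOneLower := rfl

/-- The leaf is implied by the tree's O7-ord LOWER-half statement `Additive.O7.LowerHalf` (all of row
B6's potentially-ordinary rank-one locus). [folklore] -/
theorem additiveX3RankOneLower_of_o7LowerHalf (h : Additive.O7.LowerHalf) : AdditiveX3RankOneLower := by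
  intro W _ _ p _ hr hp2 hX hS
  have hc := Additive.N10.cellM_or_cellGordTwo_of_classX3_of_subSemistableTwist W p hp2 hX hS
  exact h W p hr ((Additive.N10.locus_iff_cells W p).mpr (hc.elim Or.inl (fun h2 ↦ Or.inr (Or.inl h2))))

/-- The leaf is the LOWER half of the RANK-ONE residue of X3♯ (second conjunct of
`Additive.x3Sharp_iff_residues`). [folklore] -/
theorem additiveX3RankOneLower_of_x3RankOneResidue
    (h : ∀ (W : WeierstrassCurve ℚ) [W.IsElliptic] [W.IsGloballyMinimal] (p : ℕ) [Fact p.Prime],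
      W.analyticRank = 1 → p ≠ 2 → ClassX3 W p → Additive.SubSemistableTwist W p →
        MissingPPartAt W p) :
    AdditiveX3RankOneLower := fun W _ _ p _ hr hp2 hX hS ↦
  (lower_and_upper_of_missingPPartAt W p (h W p hr hp2 hX hS)).1

/-- Hence the leaf follows from row B6's formula statement `Additive.O7.PPart`. [folklore] -/
theorem additiveX3RankOneLower_of_o7PPart (h : Additive.O7.PPart) : AdditiveX3RankOneLower :=
  additiveX3RankOneLower_of_o7LowerHalf (Additive.O7.lowerHalf_of_pPart h)

end Summit.BirchSwinnertonDyer.BirchSwinnertonDyer.Theorems.SchneiderFree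

end
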